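import Summits.QuantumFields.BalabanUV.Beta.D1BFx.SymHessTableMass

/-!
# `BalabanUV.Beta.D1BFx.CombHessTableMass` — road «BF-x» for binder row D1, slot (K) ∕ junction (J1), direction RE-TABLE (R-D1-g55-1): **«COMB-H-TABLE-MASS» —
# THE COMB TWINS OF «H-TABLE-MASS» PART A ∕ PART B: the pair `ℓ¹` mass `Σ_{f∈S₁}Σ_{f′∈S₂} |h^ρ_{(μ,y)}(f, f′)| ≤ 2ℓ²` of an1's COMB averaging Hessian table
# `hessKerAt ρ` (lit `Beta.AveragingHessianKernelsRooted`), the `σ`-weighted block fibre masses of its packing `hessFFAt ρ L μ y`, and the (M-b) block ∕ full weighted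
# masses of `V_H = vertexOfM K₀ n (hessFFAt ρ_c n)` — the SAME numbers as the sym letters, with `symHessKerAt ∕ symHessFFAt ↦ hessKerAt ∕ hessFFAt`.**

HONEST DEPENDENCY (cell records, verbatim): «continuum YM on T⁴ ⇐ BetaPertH ∧ nine spine estimates (0/9 proved); BetaPertH ⇐ (D1) ∧ (D4) ∧
CAP+tail; G-an2-4 gates asym, D1 and NE2/3/4.»  HONEST FRAMING (cell contract, verbatim): «discharging `BetaPertH` makes Bałaban's UV stability
UNCONDITIONAL — a real constructive-QFT result; it is NOT the continuum limit and NOT the Clay problem.»  THIS MODULE DISCHARGES NOTHING of the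
wall: [folklore] list ∕ `Finset` ∕ `tsum` bookkeeping BY NAME over an1's LANDED lit count words (`hessCountAt = Σ_b wedge(loopCAt) + (lin·c − c·lin) + L^d·wedge(c)`,
`hessKerAt = count ∕ (2L^d)`, `loopCAt_map ∕ gammaCAt_map` (naturality), `lettersIn_loopCAt ∕ lettersIn_gammaCAt ∕ lettersIn_cSegAt`, `loopCAt_length_le_ell ∕
gammaCAt_length_le_ell`, `hessKerAt_eq_zero_left ∕ _right`, `hessFFAt`), this lineage's g63 PART A `SymHessTablePairMass` generic word masses (`sum_sum_abs_wedge_le_sq`,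
`sum_abs_sum_eval_le_length`, `δ1_eq_mapForm_eval`, `pairForm_δ1_eq_mapForm_eval`, `letters_of_lettersIn_univ[_pair]`, `sum_abs_cCountAt_le`, `sum_sum_abs_wedge_segUp_le`)
and PART B `SymHessTableMass` (`mem_image_nearSet'`, `wfibreMass_le_of_blk`), g61 C′ `PackedStraightColumnMixedMass.mass_blk_vertexOfM_K₀_le`.  No definition, no
`def … : Prop`, nothing cited, NO printed hypothesis, 0 sorry, default heartbeats.  A TABLE LETTER: it prices NO word and proves NO (1.22) row; 0 root-level binders of
row D1 discharged (hW ∕ hR-sockets ∕ hSX-socket ∕ D1Tel ∕ D1Rep = 0); (J1) ONE OPEN ROW; (K) NOT closed; NOT D1, NEVER «G-an2-4 closed», NOT `BetaPertH`, NOT continuum,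
NOT Clay.

ABSOLUTE RULE (cell charter, verbatim): «No internally-minted statement may enter as a cited fact. Every hypothesis is either kernel-proved in
this package or a verbatim quotation of a PUBLISHED theorem with page reference. The manuscript(s) under audit are NOT citable for their own
disputed steps — they are the thing under adjudication; programme-internal (2001/route/tribunal) claims are never citable.»

WHY (d1-leaf-03 g38 located note (i), journal l.60523; an1 g96 W-1 «free for anyone, NO CONTEST in advance», INBOX L.63777): under the row-D1 OWNER's ruling
R-D1-g55-1 (RE-TABLE, the whole comb record at `G₀`) the HEAD's rows read an2's comb record `combTablesAn1S2`, whose constraint Hessian is the COMB table `hessFFAt ρ_c`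
(lit) where the (0.4) record had `symHessFFAt ρ_c`; the consumers of record of the sym letters (`ChartDefectRowLamfClosed`, `ChartDefectRowMsScales`,
`ChartDefectRowMcolScales`, `LambdaSectorRowsPairMass`) then want exactly these twins.  The comb case is PART A §3 ∕ PART B §4–§7 read at `d! ↦ 1` (one contour
system, no order average): the wedge of ONE rooted loop summed over all bond pairs is `≤ ℓ²`, the linear word `≤ L^d·ℓ`, the straight words as before, `L ≤ ℓ`.

CONTENT.
* §1 [folklore, generic `d`, box root, `1 ≤ L`]: `sum_sum_abs_wedge_loopCAt_le` (`≤ ℓ²`), `sum_abs_linCountAt_le` (`≤ L^d·ℓ`), **`sum_sum_abs_hessCountAt_le`** (`≤ 4·L^d·ℓ²`),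
  **`sum_sum_abs_hessKerAt_le`** (`Σ_{f∈S₁}Σ_{f′∈S₂} |hessKerAt (toSite r) L μ y f f′| ≤ 2·ℓ²` — the number of ONE entry, an1's `abs_hessKerAt_le`).
* §2 [folklore, `d+1`, packed]: `blk_hessFFAt_eq_zero ∕ _tt`, `wfibreMass_blk_hessFFAt_eq_zero`, **`summable_wfibreMass_blk_hessFFAt`** (`hMs`), **`tsum_wfibreMass_blk_hessFFAt_le`**
  (`hMm`: `≤ if j ∧ k then 2·ell(d+1,L)²·e^{σ·4(d+1)L} else 0`, `0 ≤ σ`).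
* §3 [our objects + folklore, `d = 3`, `[NeZero n]`, root `ctr 4 n`]: **`wmass_blk_vertexOfM_K₀_hessFFAt_le`**, **`wmass_vertexOfM_K₀_hessFFAt_le_pairMass`** (modulo the displayed
  multiplier envelope `hΦ`, dischargeable at the consumer by d1-leaf-04 g28's `StraightPinMultiplierEnvelope.abs_wΦ_le_hΦ` as for the sym rows; `0 ≤ σ ≤ κ₀∕(16n)`).
NOT HERE (honest): the border product-chart pair mass (`vhKerAt`; on word), the comb mixed table (d1-leaf-04's ∕ an2's lane), any row, any n-law beyond the displayed `2·ell²`.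
Unit `b2b-balaban-gan24-formalise-leaf-05` (gen 65), G-an2-4 swarm leaf prover 05, road «BF-x» supplier, table-mass lineage g61–g64; INTENT-1 «COMB-H-TABLE-MASS» (journal l.60630).
Not in print; our bookkeeping.  No existing file touched.
-/

noncomputable section

open Finset
open scoped BigOperators Nat
open Literature.MathematicalPhysics.QuantumFieldTheory
open Literature.MathematicalPhysics.QuantumFieldTheory.Balaban1983to89
open Literature.MathematicalPhysics.QuantumFieldTheory.Balaban1983to89.Beta
open Literature.MathematicalPhysics.QuantumFieldTheory.Balaban1983to89.Beta.AffineAveraging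
open Literature.MathematicalPhysics.QuantumFieldTheory.Balaban1983to89.Beta.TransportedContourVariables
open Literature.MathematicalPhysics.QuantumFieldTheory.Balaban1983to89.Beta.AveragingHessianKernels

namespace Summit.QuantumFields.BalabanUV.Beta.D1BFx.CombHessTableMass

variable {d : ℕ}

/-! ## §1 The pair `ℓ¹` mass of the COMB Hessian count and kernel (one rooted contour system): the number that bounds ONE entry -/

section PairMass

open Literature.MathematicalPhysics.QuantumFieldTheory.Balaban1983to89.Beta.AveragingContours (segUp segUp_length)
open Literature.MathematicalPhysics.QuantumFieldTheory.Balaban1983to89.Beta.AveragingContoursRooted (gammaCAt loopCAt linAvgAt)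
open Literature.MathematicalPhysics.QuantumFieldTheory.Balaban1983to89.Beta.AveragingHessianKernelsRooted (gammaCAt_map loopCAt_map linCountAt cCountAt
  hessCountAt hessKerAt lettersIn_gammaCAt lettersIn_cSegAt lettersIn_loopCAt gammaCAt_length_le_ell loopCAt_length_le_ell)
open Summit.QuantumFields.BalabanUV.Beta.SymAveragingHessianCounts (card_box)
open Summit.QuantumFields.BalabanUV.Beta.D1BFx.SymHessTablePairMass (sum_abs_sum_eval_le_length sum_sum_abs_wedge_le_sq δ1_eq_mapForm_eval
  pairForm_δ1_eq_mapForm_eval letters_of_lettersIn_univ letters_of_lettersIn_univ_pair sum_abs_cCountAt_le sum_sum_abs_wedge_segUp_le)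

variable {L : ℕ} {r : Fin d → ℕ}

/-- [folklore] **PAIR MASS OF THE ROOTED LOOP WEDGE**: `Σ_{f ∈ S₁} Σ_{f′ ∈ S₂} |wedge (loopCAt ρ (δ_f, δ_{f′}) … b)| ≤ ℓ²` (box root, base point in the block) — the loop is a word
of `≤ ℓ` letters `±(δ1 g, δ1 g)` of the universal pair form (`loopCAt_map`), and PART A's `sum_sum_abs_wedge_le_sq`. -/
theorem sum_sum_abs_wedge_loopCAt_le (hL : 1 ≤ L) (hr : r ∈ box d L) (μ : Fin d) (y : Site d) {b : Fin d → ℕ} (hb : b ∈ box d L)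
    (S₁ S₂ : Finset (Bond d)) :
    ∑ f ∈ S₁, ∑ f' ∈ S₂, |wedge (loopCAt (toSite r) (pairForm (δ1 f) (δ1 f')) L μ y b)| ≤ (ell d L : ℤ) ^ 2 := by
  set l₀ := loopCAt (toSite r) (pairForm (fun κ x => δ1 (κ, x)) (fun κ x => δ1 (κ, x))) L μ y b with hl₀
  have hlet := letters_of_lettersIn_univ_pair (lettersIn_loopCAt (pairForm (fun κ x => δ1 (κ, x)) (fun κ x => δ1 (κ, x))) L μ y hr hb)
  have hlen : (l₀.length : ℤ) ≤ ell d L := by exact_mod_cast loopCAt_length_le_ell _ hL μ y hr hb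
  have hre : ∀ f f' : Bond d, loopCAt (toSite r) (pairForm (δ1 f) (δ1 f')) L μ y b = l₀.map fun q => (q.1 f.1 f.2, q.2 f'.1 f'.2) := by
    intro f f'
    rw [pairForm_δ1_eq_mapForm_eval, ← loopCAt_map]
    rfl
  simp_rw [hre]
  exact (sum_sum_abs_wedge_le_sq S₁ S₂ l₀ hlet).trans (pow_le_pow_left₀ (by positivity) hlen 2)

/-- [folklore] **SINGLE MASS OF THE ROOTED LINEAR COUNT**: `Σ_{f ∈ S} |linCountAt ρ L μ y f| ≤ L^d·ℓ` — `L^d` base points × a word of `≤ ℓ` letters `±δ1 g` (`gammaCAt_map`). -/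
theorem sum_abs_linCountAt_le (hL : 1 ≤ L) (hr : r ∈ box d L) (μ : Fin d) (y : Site d) (S : Finset (Bond d)) :
    ∑ f ∈ S, |linCountAt (toSite r) L μ y f| ≤ (L : ℤ) ^ d * (ell d L : ℤ) := by
  classical
  have hre : ∀ (b : Fin d → ℕ) (f : Bond d), (gammaCAt (toSite r) (δ1 f) L μ y b).sum
      = ((gammaCAt (toSite r) (fun κ x => δ1 (κ, x)) L μ y b).map fun q => q f.1 f.2).sum := by
    intro b f
    rw [δ1_eq_mapForm_eval, ← gammaCAt_map]
    rfl
  have hW : ∀ f : Bond d, linCountAt (toSite r) L μ y f = ∑ b ∈ box d L, (gammaCAt (toSite r) (δ1 f) L μ y b).sum := fun f => rfl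
  calc ∑ f ∈ S, |linCountAt (toSite r) L μ y f|
      ≤ ∑ f ∈ S, ∑ b ∈ box d L, |(gammaCAt (toSite r) (δ1 f) L μ y b).sum| :=
        Finset.sum_le_sum fun f _ => by rw [hW]; exact Finset.abs_sum_le_sum_abs _ _
    _ = ∑ b ∈ box d L, ∑ f ∈ S, |(gammaCAt (toSite r) (δ1 f) L μ y b).sum| := Finset.sum_comm
    _ ≤ ∑ _b ∈ box d L, (ell d L : ℤ) :=
        Finset.sum_le_sum fun b hb => by
          simp_rw [hre b]
          refine (sum_abs_sum_eval_le_length S _ (letters_of_lettersIn_univ (lettersIn_gammaCAt _ L μ y hr hb))).trans ?_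
          exact_mod_cast gammaCAt_length_le_ell _ hL μ y hr hb
    _ = (L : ℤ) ^ d * (ell d L : ℤ) := by
        rw [Finset.sum_const, nsmul_eq_mul, card_box]; push_cast; ring

/-- [folklore] **PAIR MASS OF THE COMB HESSIAN COUNT: `Σ_{f ∈ S₁} Σ_{f′ ∈ S₂} |hessCountAt ρ L μ y f f′| ≤ 4·L^d·ℓ²` — THE SAME NUMBER THAT BOUNDS ONE ENTRY** (an1's
`abs_hessCountAt_le`): loop wedges `L^d·ℓ²` + linear × straight `2·(L^dℓ)·L` + straight wedge `L^d·L²`, and `L ≤ ℓ`. -/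
theorem sum_sum_abs_hessCountAt_le (hL : 1 ≤ L) (hr : r ∈ box d L) (μ : Fin d) (y : Site d) (S₁ S₂ : Finset (Bond d)) :
    ∑ f ∈ S₁, ∑ f' ∈ S₂, |hessCountAt (toSite r) L μ y f f'| ≤ 4 * (L : ℤ) ^ d * (ell d L : ℤ) ^ 2 := by
  classical
  have hℓ : (L : ℤ) ≤ ell d L := by exact_mod_cast le_ell
  have hL0 : (0 : ℤ) ≤ L := by positivity
  have hLd : (0 : ℤ) ≤ (L : ℤ) ^ d := by positivity
  -- the loop wedges, base point by base point
  have hW : ∑ f ∈ S₁, ∑ f' ∈ S₂, |∑ b ∈ box d L, wedge (loopCAt (toSite r) (pairForm (δ1 f) (δ1 f')) L μ y b)|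
      ≤ (L : ℤ) ^ d * (ell d L : ℤ) ^ 2 := by
    calc ∑ f ∈ S₁, ∑ f' ∈ S₂, |∑ b ∈ box d L, wedge (loopCAt (toSite r) (pairForm (δ1 f) (δ1 f')) L μ y b)|
        ≤ ∑ f ∈ S₁, ∑ f' ∈ S₂, ∑ b ∈ box d L, |wedge (loopCAt (toSite r) (pairForm (δ1 f) (δ1 f')) L μ y b)| :=
          Finset.sum_le_sum fun f _ => Finset.sum_le_sum fun f' _ => Finset.abs_sum_le_sum_abs _ _
      _ = ∑ b ∈ box d L, ∑ f ∈ S₁, ∑ f' ∈ S₂, |wedge (loopCAt (toSite r) (pairForm (δ1 f) (δ1 f')) L μ y b)| := by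
          have h1 : ∀ f : Bond d, ∑ f' ∈ S₂, ∑ b ∈ box d L, |wedge (loopCAt (toSite r) (pairForm (δ1 f) (δ1 f')) L μ y b)|
              = ∑ b ∈ box d L, ∑ f' ∈ S₂, |wedge (loopCAt (toSite r) (pairForm (δ1 f) (δ1 f')) L μ y b)| := fun f => Finset.sum_comm
          rw [Finset.sum_congr rfl (fun f _ => h1 f), Finset.sum_comm]
      _ ≤ ∑ _b ∈ box d L, (ell d L : ℤ) ^ 2 := Finset.sum_le_sum fun b hb => sum_sum_abs_wedge_loopCAt_le hL hr μ y hb S₁ S₂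
      _ = (L : ℤ) ^ d * (ell d L : ℤ) ^ 2 := by rw [Finset.sum_const, nsmul_eq_mul, card_box]; push_cast; ring
  have hA₁ := sum_abs_linCountAt_le hL hr μ y S₁
  have hA₂ := sum_abs_linCountAt_le hL hr μ y S₂
  have hC₁ := sum_abs_cCountAt_le hr μ y S₁
  have hC₂ := sum_abs_cCountAt_le hr μ y S₂
  have hS := sum_sum_abs_wedge_segUp_le (L := L) hr μ y S₁ S₂
  have hA₁n : 0 ≤ ∑ f ∈ S₁, |linCountAt (toSite r) L μ y f| := Finset.sum_nonneg fun _ _ => abs_nonneg _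
  have hA₂n : 0 ≤ ∑ f ∈ S₂, |linCountAt (toSite r) L μ y f| := Finset.sum_nonneg fun _ _ => abs_nonneg _
  have hC₂n : 0 ≤ ∑ f ∈ S₂, |cCountAt (toSite r) L μ y f| := Finset.sum_nonneg fun _ _ => abs_nonneg _
  -- termwise triangle inequality
  have hterm : ∀ f f' : Bond d, |hessCountAt (toSite r) L μ y f f'|
      ≤ |∑ b ∈ box d L, wedge (loopCAt (toSite r) (pairForm (δ1 f) (δ1 f')) L μ y b)|
        + (|linCountAt (toSite r) L μ y f| * |cCountAt (toSite r) L μ y f'| + |cCountAt (toSite r) L μ y f| * |linCountAt (toSite r) L μ y f'|)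
        + (L : ℤ) ^ d * |wedge (segUp (pairForm (δ1 f) (δ1 f')) ((L : ℤ) • y + toSite r) μ L)| := by
    intro f f'
    rw [hessCountAt]
    refine (abs_add_le _ _).trans (add_le_add ((abs_add_le _ _).trans (add_le_add le_rfl ?_)) ?_)
    · refine (abs_sub _ _).trans (add_le_add ?_ ?_)
      · rw [abs_mul]
      · rw [abs_mul, mul_comm]
    · rw [abs_mul, abs_of_nonneg hLd]
  calc ∑ f ∈ S₁, ∑ f' ∈ S₂, |hessCountAt (toSite r) L μ y f f'|
      ≤ ∑ f ∈ S₁, ∑ f' ∈ S₂, (|∑ b ∈ box d L, wedge (loopCAt (toSite r) (pairForm (δ1 f) (δ1 f')) L μ y b)|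
        + (|linCountAt (toSite r) L μ y f| * |cCountAt (toSite r) L μ y f'| + |cCountAt (toSite r) L μ y f| * |linCountAt (toSite r) L μ y f'|)
        + (L : ℤ) ^ d * |wedge (segUp (pairForm (δ1 f) (δ1 f')) ((L : ℤ) • y + toSite r) μ L)|) :=
        Finset.sum_le_sum fun f _ => Finset.sum_le_sum fun f' _ => hterm f f'
    _ = (∑ f ∈ S₁, ∑ f' ∈ S₂, |∑ b ∈ box d L, wedge (loopCAt (toSite r) (pairForm (δ1 f) (δ1 f')) L μ y b)|)
        + ((∑ f ∈ S₁, |linCountAt (toSite r) L μ y f|) * (∑ f' ∈ S₂, |cCountAt (toSite r) L μ y f'|)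
            + (∑ f ∈ S₁, |cCountAt (toSite r) L μ y f|) * (∑ f' ∈ S₂, |linCountAt (toSite r) L μ y f'|))
        + (L : ℤ) ^ d * ∑ f ∈ S₁, ∑ f' ∈ S₂, |wedge (segUp (pairForm (δ1 f) (δ1 f')) ((L : ℤ) • y + toSite r) μ L)| := by
        rw [Finset.sum_mul_sum, Finset.sum_mul_sum, ← Finset.sum_add_distrib, Finset.mul_sum, ← Finset.sum_add_distrib, ← Finset.sum_add_distrib]
        refine Finset.sum_congr rfl fun f _ => ?_
        rw [← Finset.sum_add_distrib, Finset.mul_sum, ← Finset.sum_add_distrib, ← Finset.sum_add_distrib]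
    _ ≤ (L : ℤ) ^ d * (ell d L : ℤ) ^ 2
        + (((L : ℤ) ^ d * (ell d L : ℤ)) * (L : ℤ) + (L : ℤ) * ((L : ℤ) ^ d * (ell d L : ℤ)))
        + (L : ℤ) ^ d * (L : ℤ) ^ 2 := by
        refine add_le_add (add_le_add hW (add_le_add ?_ ?_)) (mul_le_mul_of_nonneg_left hS hLd)
        · exact mul_le_mul hA₁ hC₂ hC₂n (hA₁n.trans hA₁)
        · exact mul_le_mul hC₁ hA₂ hA₂n hL0
    _ ≤ 4 * (L : ℤ) ^ d * (ell d L : ℤ) ^ 2 := by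
        have h1 : (L : ℤ) * (ell d L : ℤ) ≤ (ell d L : ℤ) ^ 2 := by nlinarith
        have h2 : (L : ℤ) ^ 2 ≤ (ell d L : ℤ) ^ 2 := pow_le_pow_left₀ hL0 hℓ 2
        nlinarith

/-- [folklore] **PAIR `ℓ¹` MASS OF THE COMB AVERAGING HESSIAN TABLE: `Σ_{f ∈ S₁} Σ_{f′ ∈ S₂} |h^ρ_{(μ,y)}(f, f′)| ≤ 2ℓ²`** (box root, `1 ≤ L`) — the SAME number as an1's
entrywise `abs_hessKerAt_le`: summing the table over ALL bond pairs costs nothing beyond ONE entry's bound.  The comb twin of PART A `sum_sum_abs_symHessKerAt_le`. -/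
theorem sum_sum_abs_hessKerAt_le (hL : 1 ≤ L) (hr : r ∈ box d L) (μ : Fin d) (y : Site d) (S₁ S₂ : Finset (Bond d)) :
    ∑ f ∈ S₁, ∑ f' ∈ S₂, |hessKerAt (toSite r) L μ y f f'| ≤ 2 * (ell d L : ℝ) ^ 2 := by
  have hden : (0 : ℝ) < 2 * (L : ℝ) ^ d := by positivity
  have h := sum_sum_abs_hessCountAt_le hL hr μ y S₁ S₂
  have h' : (∑ f ∈ S₁, ∑ f' ∈ S₂, |(hessCountAt (toSite r) L μ y f f' : ℝ)|) ≤ 4 * (L : ℝ) ^ d * (ell d L : ℝ) ^ 2 := by exact_mod_cast h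
  have e : ∀ f f' : Bond d, |hessKerAt (toSite r) L μ y f f'| = |(hessCountAt (toSite r) L μ y f f' : ℝ)| / (2 * (L : ℝ) ^ d) := by
    intro f f'
    rw [hessKerAt, abs_div, abs_of_pos hden]
  simp_rw [e, ← Finset.sum_div]
  rw [div_le_iff₀ hden]
  nlinarith

end PairMass

/-! ## §2 The packed table `hessFFAt ρ L μ y` in WEIGHTED `ℓ¹` currency: the `hMs ∕ hMm` sockets of g61 C′ `PackedStraightColumnMixedMass.mass_blk_vertexOfM_K₀_le` -/

section Packed

open Literature.MathematicalPhysics.QuantumFieldTheory.Balaban1983to89.Beta.AveragingHessianKernelsRooted (hessKerAt hessFFAt hessKerAt_eq_zero_left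
  hessKerAt_eq_zero_right hessFFAt_inl_inl hessFFAt_inl_inr hessFFAt_inr)
open Summit.QuantumFields.BalabanUV.Beta.D1BFx.PackedKernelSplit (blk)
open Summit.QuantumFields.BalabanUV.Beta.D1BFx.SymHessTableMass (mem_image_nearSet')
open Literature.MathematicalPhysics.QuantumFieldTheory.Balaban1983to89.Beta.AveragingMixedJetTables (nearSet mem_nearSet near_zero_iff)
open B12Sec2to5 (l1 l1_nonneg)

variable {L : ℕ} {r : Fin (d + 1) → ℕ}

/-- [folklore] Off the field–field block the packed comb Hessian table vanishes. -/
theorem blk_hessFFAt_eq_zero (ρ : Fin (d + 1) → ℤ) (L : ℕ) (μ : Fin (d + 1)) (y : Fin (d + 1) → ℤ) {j k : Bool} (h : ¬ (j = true ∧ k = true)) :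
    blk (hessFFAt ρ L μ y) j k = 0 := by
  funext x x' a b
  cases j <;> cases k
  · rfl
  · rfl
  · rfl
  · exact absurd ⟨rfl, rfl⟩ h

/-- [folklore] The field–field block of the packed comb Hessian table, entrywise. -/
theorem blk_hessFFAt_tt (ρ : Fin (d + 1) → ℤ) (L : ℕ) (μ : Fin (d + 1)) (y : Fin (d + 1) → ℤ) (x x' : Fin (d + 1) → ℤ) (α α' : Fin (d + 1)) :
    blk (hessFFAt ρ L μ y) true true x x' α α' = hessKerAt ρ L μ y (α, x) (α', x') := rfl

/-- [folklore] **FINITE SUPPORT**: the weighted fibre mass of every block of `hessFFAt (toSite r) L μ y` vanishes off `near(y) × near(y)`. -/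
theorem wfibreMass_blk_hessFFAt_eq_zero (hr : r ∈ box (d + 1) L) (μ : Fin (d + 1)) (y : Fin (d + 1) → ℤ) (j k : Bool) (w : Site (d + 1) × Site (d + 1) → ℝ)
    {p : Site (d + 1) × Site (d + 1)}
    (hp : p ∉ (nearSet (d + 1) L).image (fun x₀ => x₀ + (L : ℤ) • y) ×ˢ (nearSet (d + 1) L).image (fun x₀ => x₀ + (L : ℤ) • y)) :
    ∑ g : Fin (d + 1), ∑ f : Fin (d + 1), |blk (hessFFAt (toSite r) L μ y) j k p.1 p.2 g f| * w p = 0 := by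
  by_cases hjk : j = true ∧ k = true
  · obtain ⟨rfl, rfl⟩ := hjk
    rw [Finset.mem_product, not_and_or, mem_image_nearSet', mem_image_nearSet'] at hp
    refine Finset.sum_eq_zero fun g _ => Finset.sum_eq_zero fun f _ => ?_
    rw [blk_hessFFAt_tt]
    rcases hp with h1 | h2
    · rw [hessKerAt_eq_zero_left hr (f := (g, p.1)) h1, abs_zero, zero_mul]
    · rw [hessKerAt_eq_zero_right hr _ (f' := (f, p.2)) h2, abs_zero, zero_mul]
  · simp [blk_hessFFAt_eq_zero (toSite r) L μ y hjk]

/-- [folklore] **`hMs` FOR THE COMB HESSIAN TABLE**: every block's centred `σ`-weighted fibre mass is summable (finite support). -/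
theorem summable_wfibreMass_blk_hessFFAt (hr : r ∈ box (d + 1) L) (σ : ℝ) (μ : Fin (d + 1)) (y : Fin (d + 1) → ℤ) (j k : Bool) :
    Summable fun p : Site (d + 1) × Site (d + 1) => ∑ g : Fin (d + 1), ∑ f : Fin (d + 1),
      |blk (hessFFAt (toSite r) L μ y) j k p.1 p.2 g f| * Real.exp (σ * (l1 (p.1 - (L : ℤ) • y) + l1 (p.2 - (L : ℤ) • y))) :=
  summable_of_ne_finset_zero fun _ hp =>
    wfibreMass_blk_hessFFAt_eq_zero hr μ y j k (fun p => Real.exp (σ * (l1 (p.1 - (L : ℤ) • y) + l1 (p.2 - (L : ℤ) • y)))) hp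

/-- [folklore] **`hMm` FOR THE COMB HESSIAN TABLE, WITH THE PAIR MASS `2ℓ²`**: for `0 ≤ σ`, every block's centred `σ`-weighted fibre mass of `hessFFAt (toSite r) L μ y` is
`≤ (if j ∧ k then 2·ℓ²·e^{σ·4(d+1)L} else 0)` — §1's pair mass against the weight's sup on the support box (`l1_le_of_near`).  The comb twin of PART B
`tsum_wfibreMass_blk_symHessFFAt_le`, same right-hand side. -/
theorem tsum_wfibreMass_blk_hessFFAt_le (hL : 1 ≤ L) (hr : r ∈ box (d + 1) L) {σ : ℝ} (hσ : 0 ≤ σ) (μ : Fin (d + 1)) (y : Fin (d + 1) → ℤ)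
    (j k : Bool) :
    ∑' p : Site (d + 1) × Site (d + 1), ∑ g : Fin (d + 1), ∑ f : Fin (d + 1),
        |blk (hessFFAt (toSite r) L μ y) j k p.1 p.2 g f| * Real.exp (σ * (l1 (p.1 - (L : ℤ) • y) + l1 (p.2 - (L : ℤ) • y)))
      ≤ if j = true ∧ k = true then 2 * (ell (d + 1) L : ℝ) ^ 2 * Real.exp (σ * (4 * (((d : ℝ) + 1) * L))) else 0 := by
  classical
  set NS : Finset (Site (d + 1)) := (nearSet (d + 1) L).image (fun x₀ => x₀ + (L : ℤ) • y) with hNS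
  rw [tsum_eq_sum (s := NS ×ˢ NS) (fun p hp => wfibreMass_blk_hessFFAt_eq_zero hr μ y j k
    (fun p => Real.exp (σ * (l1 (p.1 - (L : ℤ) • y) + l1 (p.2 - (L : ℤ) • y)))) (by rw [hNS] at hp; exact hp))]
  by_cases hjk : j = true ∧ k = true
  · obtain ⟨rfl, rfl⟩ := hjk
    rw [if_pos ⟨rfl, rfl⟩]
    set E : ℝ := Real.exp (σ * (4 * (((d : ℝ) + 1) * L))) with hE
    -- the weight on the support box
    have hw : ∀ p ∈ NS ×ˢ NS, Real.exp (σ * (l1 (p.1 - (L : ℤ) • y) + l1 (p.2 - (L : ℤ) • y))) ≤ E := by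
      intro p hp
      obtain ⟨h1, h2⟩ := Finset.mem_product.1 hp
      rw [hNS, mem_image_nearSet'] at h1 h2
      have d1 := l1_le_of_near h1 (near_self hL y)
      have d2 := l1_le_of_near h2 (near_self hL y)
      exact Real.exp_le_exp.2 (by nlinarith)
    -- the pair mass of the table on the support bonds
    have hmass : ∑ p ∈ NS ×ˢ NS, ∑ g : Fin (d + 1), ∑ f : Fin (d + 1), |hessKerAt (toSite r) L μ y (g, p.1) (f, p.2)|
        ≤ 2 * (ell (d + 1) L : ℝ) ^ 2 := by
      have h := sum_sum_abs_hessKerAt_le hL hr μ y (Finset.univ ×ˢ NS) (Finset.univ ×ˢ NS)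
      rw [Finset.sum_product_right] at h
      refine le_trans (le_of_eq ?_) h
      rw [Finset.sum_product]
      refine Finset.sum_congr rfl fun x _ => ?_
      rw [Finset.sum_comm]
      refine Finset.sum_congr rfl fun g _ => ?_
      rw [Finset.sum_product_right]
    calc ∑ p ∈ NS ×ˢ NS, ∑ g : Fin (d + 1), ∑ f : Fin (d + 1),
          |blk (hessFFAt (toSite r) L μ y) true true p.1 p.2 g f| * Real.exp (σ * (l1 (p.1 - (L : ℤ) • y) + l1 (p.2 - (L : ℤ) • y)))
        ≤ ∑ p ∈ NS ×ˢ NS, ∑ g : Fin (d + 1), ∑ f : Fin (d + 1), |hessKerAt (toSite r) L μ y (g, p.1) (f, p.2)| * E :=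
          Finset.sum_le_sum fun p hp => Finset.sum_le_sum fun g _ => Finset.sum_le_sum fun f _ => by
            rw [blk_hessFFAt_tt]; exact mul_le_mul_of_nonneg_left (hw p hp) (abs_nonneg _)
      _ = (∑ p ∈ NS ×ˢ NS, ∑ g : Fin (d + 1), ∑ f : Fin (d + 1), |hessKerAt (toSite r) L μ y (g, p.1) (f, p.2)|) * E := by
          rw [Finset.sum_mul]; refine Finset.sum_congr rfl fun p _ => ?_
          rw [Finset.sum_mul]; refine Finset.sum_congr rfl fun g _ => ?_
          rw [Finset.sum_mul]
      _ ≤ 2 * (ell (d + 1) L : ℝ) ^ 2 * E := mul_le_mul_of_nonneg_right hmass (Real.exp_pos _).le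
  · rw [if_neg hjk]
    refine le_of_eq (Finset.sum_eq_zero fun p _ => ?_)
    simp [blk_hessFFAt_eq_zero (toSite r) L μ y hjk]

end Packed

/-! ## §3 `d = 3`, the comb record's root `ρ_c = ctr 4 n`: the σ-weighted block and full masses of `V_H := vertexOfM K₀ n (hessFFAt ρ_c n)` with the TABLE's PAIR MASS `2·ell(4,n)²` -/

section Record

open B12Sec2to5 (l1)
open B4ContourShift (supNorm)
open ExpKernelCalculus (Zl MKer)
open KernelSpecInstance (wΦ)
open OneStepResolventKernel (Fib)
open OneStepKernelFamily (KInvStep)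
open SecondOrderResponse (vertexOfM)
open AveragingContoursRooted (ctr ctrOff ctrOff_mem_box)
open Literature.MathematicalPhysics.QuantumFieldTheory.Balaban1983to89.Beta.AveragingHessianKernelsRooted (hessFFAt)
open Summit.QuantumFields.BalabanUV.Beta.D1BFx.PackedKernelSplit (blk)
open Summit.QuantumFields.BalabanUV.Beta.D1BFx.PackedStraightColumnMixedMass (mass_blk_vertexOfM_K₀_le)
open Summit.QuantumFields.BalabanUV.Beta.D1BFx.SymHessTableMass (wfibreMass_le_of_blk)

variable (n : ℕ) [NeZero n]

/-- [our objects + folklore] **«COMB-H-TABLE-MASS» AT THE COMB RECORD — THE (M-b) BLOCK MASSES OF `V_H = vertexOfM K₀ n (hessFFAt ρ_c n)` WITH THE TABLE READ IN `ℓ¹`**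
(modulo the displayed multiplier envelope `hΦ`, `0 < κ₀`; `0 ≤ σ ≤ κ₀∕(16n)`): every block of `V_H ν y′` has its `n•y′`-centred `σ`-weighted fibre mass summable and
`≤ ((n⁵)⁻¹·(n³)⁻¹)·(4·CΦ·e^{κ₀}·e^{κ₀∕2}·Zl 4 (κ₀∕8))·(if j ∧ k then 2·ell(4,n)²·e^{σ·4·(4n)} else 0)` — g61 C′ `mass_blk_vertexOfM_K₀_le` fed with §2's `hMs ∕ hMm`.  The comb
twin of PART B `wmass_blk_vertexOfM_K₀_symHessFFAt_le`, same right-hand side (`SymHessTableMass.exp_weight_le_of_rate`: `e^{σ·16n} ≤ e^{κ₀}`). -/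
theorem wmass_blk_vertexOfM_K₀_hessFFAt_le {CΦ κ₀ : ℝ} (hκ₀ : 0 < κ₀)
    (hΦ : ∀ (ρ ν : Fin (3 + 1)) (w : Fin (3 + 1) → ℤ),
      |wΦ (N := n) ρ ν w| ≤ CΦ * ((n : ℝ) ^ 5)⁻¹ * ((n : ℝ) ^ 3)⁻¹ * Real.exp (-(κ₀ * supNorm w)))
    {σ : ℝ} (hσ0 : 0 ≤ σ) (hσ : σ ≤ κ₀ / (16 * (n : ℝ))) (ν : Fin (3 + 1)) (y' : Fin (3 + 1) → ℤ) (j k : Bool) :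
    (Summable fun p : Site (3 + 1) × Site (3 + 1) => ∑ g, ∑ f,
        |blk (vertexOfM (KInvStep (d := 3) n 0) n (hessFFAt (ctr 4 n) n) ν y') j k p.1 p.2 g f|
          * Real.exp (σ * (l1 (p.1 - (n : ℤ) • y') + l1 (p.2 - (n : ℤ) • y')))) ∧
      ∑' p : Site (3 + 1) × Site (3 + 1), ∑ g, ∑ f,
          |blk (vertexOfM (KInvStep (d := 3) n 0) n (hessFFAt (ctr 4 n) n) ν y') j k p.1 p.2 g f|
            * Real.exp (σ * (l1 (p.1 - (n : ℤ) • y') + l1 (p.2 - (n : ℤ) • y')))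
        ≤ (((n : ℝ) ^ 5)⁻¹ * ((n : ℝ) ^ 3)⁻¹) * (4 * CΦ * Real.exp κ₀ * Real.exp (κ₀ / 2) * Zl 4 (κ₀ / 8))
            * (if j = true ∧ k = true then 2 * (ell (3 + 1) n : ℝ) ^ 2 * Real.exp (σ * (4 * (((3 : ℝ) + 1) * n))) else 0) := by
  have hn : 1 ≤ n := Nat.one_le_iff_ne_zero.2 (NeZero.ne n)
  have hr := ctrOff_mem_box (d := 3 + 1) hn
  exact mass_blk_vertexOfM_K₀_le n hκ₀ hΦ hσ0 hσ ν y'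
    (fun ρ' w j' k' => summable_wfibreMass_blk_hessFFAt hr σ ρ' w j' k')
    (fun ρ' w j' k' => tsum_wfibreMass_blk_hessFFAt_le hn hr hσ0 ρ' w j' k') j k

/-- [our objects + folklore] **THE `MV` LETTER OF THE COMB `V_H` WITH THE PAIR MASS** (the comb twin of PART B `wmass_vertexOfM_K₀_symHessFFAt_le_pairMass` — d1-leaf-03's
`hV` socket shape of `ChartDefectRowMsScales` ∕ `ChartDefectRowMcolScales` with `symHessFFAt ↦ hessFFAt`):
`Σ'_{pr} (Σ_{a b} |vertexOfM K₀ n (hessFFAt ρ_c n) ν y′ pr.1 pr.2 a b|)·e^{σ(|pr.1 − n•y′|₁ + |pr.2 − n•y′|₁)} ≤ ((n⁵)⁻¹(n³)⁻¹)·(4CΦe^{κ₀}e^{κ₀∕2}Zl 4(κ₀∕8))·(2·ell(4,n)²·e^{σ·4·(4n)})`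
(modulo `hΦ`; `0 ≤ σ ≤ κ₀∕(16n)`; NO second rate, NO lattice volume at a fine rate). -/
theorem wmass_vertexOfM_K₀_hessFFAt_le_pairMass {CΦ κ₀ : ℝ} (hκ₀ : 0 < κ₀)
    (hΦ : ∀ (ρ ν : Fin (3 + 1)) (w : Fin (3 + 1) → ℤ),
      |wΦ (N := n) ρ ν w| ≤ CΦ * ((n : ℝ) ^ 5)⁻¹ * ((n : ℝ) ^ 3)⁻¹ * Real.exp (-(κ₀ * supNorm w)))
    {σ : ℝ} (hσ0 : 0 ≤ σ) (hσ : σ ≤ κ₀ / (16 * (n : ℝ))) (ν : Fin (3 + 1)) (y' : Site (3 + 1)) :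
    (Summable fun pr : Site (3 + 1) × Site (3 + 1) =>
        (∑ a : Fib 3, ∑ b : Fib 3, |vertexOfM (KInvStep (d := 3) n 0) n (hessFFAt (ctr 4 n) n) ν y' pr.1 pr.2 a b|)
          * Real.exp (σ * (l1 (pr.1 - (n : ℤ) • y') + l1 (pr.2 - (n : ℤ) • y')))) ∧
      ∑' pr : Site (3 + 1) × Site (3 + 1),
          (∑ a : Fib 3, ∑ b : Fib 3, |vertexOfM (KInvStep (d := 3) n 0) n (hessFFAt (ctr 4 n) n) ν y' pr.1 pr.2 a b|)
            * Real.exp (σ * (l1 (pr.1 - (n : ℤ) • y') + l1 (pr.2 - (n : ℤ) • y')))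
        ≤ (((n : ℝ) ^ 5)⁻¹ * ((n : ℝ) ^ 3)⁻¹) * (4 * CΦ * Real.exp κ₀ * Real.exp (κ₀ / 2) * Zl 4 (κ₀ / 8))
            * (2 * (ell (3 + 1) n : ℝ) ^ 2 * Real.exp (σ * (4 * (((3 : ℝ) + 1) * n)))) := by
  have hblk := fun j k => wmass_blk_vertexOfM_K₀_hessFFAt_le n hκ₀ hΦ hσ0 hσ ν y' j k
  have h := wfibreMass_le_of_blk (W := vertexOfM (KInvStep (d := 3) n 0) n (hessFFAt (ctr 4 n) n) ν y')
    (fun q : Site (3 + 1) × Site (3 + 1) => Real.exp (σ * (l1 (q.1 - (n : ℤ) • y') + l1 (q.2 - (n : ℤ) • y'))))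
    (B := fun j k => (((n : ℝ) ^ 5)⁻¹ * ((n : ℝ) ^ 3)⁻¹) * (4 * CΦ * Real.exp κ₀ * Real.exp (κ₀ / 2) * Zl 4 (κ₀ / 8))
      * (if j = true ∧ k = true then 2 * (ell (3 + 1) n : ℝ) ^ 2 * Real.exp (σ * (4 * (((3 : ℝ) + 1) * n))) else 0)) hblk
  refine ⟨h.1, h.2.trans (le_of_eq ?_)⟩
  simp

end Record

end Summit.QuantumFields.BalabanUV.Beta.D1BFx.CombHessTableMass

end
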